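/-
Copyright (c) 2026. All rights reserved.
Released under Apache 2.0 license as described in the file LICENSE.
Authors: HodgeCM publication cell (pub-hodgecm), GR lane, seat GR-2 (`pub-hodgecm-own-hyp34`).
-/
import Literature.NumberTheory.Automorphic.UnitaryGroupSymplecticCarriers
import HarnessLib

/-!
# [GelbartRogawski1991, §3.1]: a skew-Hermitian space `(V, Φ)` over a quadratic extension has a `Φ`-ORTHOGONAL basis,
# with purely imaginary diagonal values `Φ(bᵢ, bᵢ) = fᵢ δ`

Topic `NumberTheory/GelbartRogawski1991`; namespace `Literature.NumberTheory.GelbartRogawski1991.Prop311`.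
Proved lemmas only; nothing of [GelbartRogawski1991] is asserted.

[GelbartRogawski1991, §3.1 p. 454 L37–38]: "*Let `(V, Φ)` be a skew Hermitian space, where `V` is an `n`-dimensional
vector space over `E`.*"  The statement-exact typing `Prop311AsPrinted` carries `Φ : V →ₗ[F] V →ₗ[F] E` with the printed
axioms `Φ(e x, y) = e Φ(x, y)`, `Φ(x, e y) = Φ(x, y) σ(e)`, `Φ(y, x) = -σ(Φ(x, y))` as hypotheses.  The frame files
(`Prop311PrintedSymplecticFrame`, `…SymplecticRational`) read print's `Sp_𝐀(W)`, `G(𝐀) ⊂ Sp_𝐀(W)` and `Sp_F(W)` in the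
tree's matrix carriers in a `Φ`-ORTHOGONAL `E`-basis `b` with `Φ(bᵢ, bᵢ) = fᵢ δ`, `fᵢ ∈ F`.  This file proves that such a
basis EXISTS (Gram–Schmidt for `σ`-sesquilinear forms, `σ ≠ 1`, characteristic `0`):

* §1 `apply_self_eq_im_mul_delta`: a skew value `z = -σ z` is purely imaginary, `z = (im z) δ` — so `Φ(x, x) = f δ`;
* §2 `eq_zero_of_forall_apply_self_eq_zero`: a skew-Hermitian `Φ` with `Φ(x, x) = 0` for all `x` vanishes (polarisation:
  `Φ(x, y) ∈ F`, and `Φ(δ x, y) = δ Φ(x, y) ∈ F` forces `Φ(x, y) = 0`);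
* §3 the orthogonal splitting off an anisotropic vector (`orthogonalComplement`, `finrank_orthogonalComplement`,
  the restricted form `restrictForm`) and **`exists_orthogonal_basis`**: there is an `E`-basis
  `b : Basis (Fin (finrank E V)) E V` with `Φ(bᵢ, bⱼ) = 0` for `i ≠ j`; with §1,
  **`exists_orthogonal_basis_imaginary`**: moreover `Φ(bᵢ, bᵢ) = fᵢ δ` for some `f : Fin n → F`.

## References
* [GelbartRogawski1991] S. Gelbart, J. Rogawski, Invent. Math. 105 (1991) 445–472, §3.1 p. 454 L37–42.
* [Scharlau1985HermitianForms] W. Scharlau, *Quadratic and Hermitian Forms*, Grundlehren 270 (1985), Ch. 7 §6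
  (orthogonal bases of `ε`-hermitian spaces over division rings with involution).
-/

set_option autoImplicit false

noncomputable section

open Module
open Literature.NumberTheory.Automorphic
open Literature.NumberTheory.Automorphic.UnitaryGroup

namespace Literature.NumberTheory.GelbartRogawski1991

namespace Prop311

open QuadraticCoordinates

variable (F : Type) [Field F] [NumberField F]
variable (E : Type) [Field E] [NumberField E] [Algebra F E] [Algebra.IsQuadraticExtension F E]
variable (σ : E ≃ₐ[F] E) {δ : E} (hσδ : σ δ = -δ) (hδ : δ ≠ 0) {d : F} (hd : δ * δ = algebraMap F E d)

/-! ## §1. Skew values are purely imaginary -/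

section Imaginary

include hd in
/-- **a `σ`-skew element is purely imaginary**: `σ z = -z ⇒ z = (im z) · δ` in the quadratic coordinates `E = F ⊕ F δ`.
[cite: GelbartRogawski1991, §1.1 p. 449 L26; §3.1 p. 454 L37–38] -/
theorem eq_im_mul_delta_of_conj_eq_neg {z : E} (hz : σ z = -z) :
    z = algebraMap F E (im (quadraticRatCoords E (not_mem_range_algebraMap_of_apply_eq_neg E σ hσδ hδ)).toAddEquiv z) * δ := by
  have hF := isQuadraticCoordinates_rat E σ hσδ hδ hd
  have hre : re (quadraticRatCoords E (not_mem_range_algebraMap_of_apply_eq_neg E σ hσδ hδ)).toAddEquiv z = 0 := by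
    have h := hF.re_conj (σ := (σ : E →+* E)) (fun a => σ.commutes a) hσδ z
    rw [RingHom.coe_coe, hz, map_neg] at h
    exact add_self_eq_zero.1 (eq_neg_iff_add_eq_zero.1 h.symm)
  conv_lhs => rw [← hF.re_add_im z]
  rw [hre, map_zero, zero_add]

variable {V : Type} [AddCommGroup V] [Module F V]

include hd in
/-- **`Φ(x, x) = f δ` with `f = im Φ(x, x) ∈ F`** for a skew-Hermitian `Φ` (`Φ(y, x) = -σ Φ(x, y)`).
[cite: GelbartRogawski1991, §3.1 p. 454 L37–38] -/
theorem apply_self_eq_im_mul_delta (Φ : V →ₗ[F] V →ₗ[F] E) (hΦ₃ : ∀ x y : V, Φ y x = -σ (Φ x y)) (x : V) :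
    Φ x x = algebraMap F E
      (im (quadraticRatCoords E (not_mem_range_algebraMap_of_apply_eq_neg E σ hσδ hδ)).toAddEquiv (Φ x x)) * δ :=
  eq_im_mul_delta_of_conj_eq_neg F E σ hσδ hδ hd (by rw [eq_neg_iff_add_eq_zero, ← neg_eq_iff_add_eq_zero, ← hΦ₃])

end Imaginary

/-! ## §2. A totally isotropic skew-Hermitian form vanishes -/

section Vanishing

variable {V : Type} [AddCommGroup V] [Module F V] [Module E V]

omit [NumberField F] [Algebra.IsQuadraticExtension F E] in
include hσδ hδ in
/-- **polarisation**: if `Φ(x, x) = 0` for all `x` then `Φ = 0` (`Φ(x, y) = -Φ(y, x) = σ Φ(x, y)` is `σ`-fixed, and so is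
`Φ(δ x, y) = δ Φ(x, y)`, whence `2 δ Φ(x, y) = 0`). [cite: GelbartRogawski1991, §3.1 p. 454 L37–38] -/
theorem eq_zero_of_forall_apply_self_eq_zero (Φ : V →ₗ[F] V →ₗ[F] E)
    (hΦ₁ : ∀ (e : E) (x y : V), Φ (e • x) y = e * Φ x y) (hΦ₃ : ∀ x y : V, Φ y x = -σ (Φ x y))
    (h0 : ∀ x : V, Φ x x = 0) (x y : V) : Φ x y = 0 := by
  -- `Φ(x, y) + Φ(y, x) = 0` by polarisation, hence `σ Φ(x, y) = Φ(x, y)`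
  have hpol : ∀ x y : V, σ (Φ x y) = Φ x y := fun x y => by
    have h := h0 (x + y)
    simp only [map_add, LinearMap.add_apply, h0, zero_add, add_zero] at h
    rw [hΦ₃ x y, neg_add_eq_zero] at h
    exact h
  have h1 := hpol (δ • x) y
  rw [hΦ₁, map_mul, hσδ, hpol, neg_mul, neg_eq_iff_add_eq_zero, add_self_eq_zero, mul_eq_zero] at h1
  exact h1.resolve_left hδ

omit [NumberField F] [Algebra.IsQuadraticExtension F E] in
include hσδ hδ in
/-- hence a NON-ZERO skew-Hermitian form has an anisotropic vector. [cite: GelbartRogawski1991, §3.1 p. 454 L37–38] -/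
theorem exists_apply_self_ne_zero (Φ : V →ₗ[F] V →ₗ[F] E)
    (hΦ₁ : ∀ (e : E) (x y : V), Φ (e • x) y = e * Φ x y) (hΦ₃ : ∀ x y : V, Φ y x = -σ (Φ x y))
    (hΦ : Φ ≠ 0) : ∃ x : V, Φ x x ≠ 0 := by
  by_contra h
  simp only [not_exists, not_not] at h
  exact hΦ (LinearMap.ext fun x => LinearMap.ext fun y =>
    eq_zero_of_forall_apply_self_eq_zero F E σ hσδ hδ Φ hΦ₁ hΦ₃ h x y)

end Vanishing

/-! ## §3. Splitting off an anisotropic vector; the orthogonal basis -/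

section Orthogonal

variable {V : Type} [AddCommGroup V] [Module F V] [Module E V] [IsScalarTower F E V]

omit [NumberField F] [NumberField E] [Algebra.IsQuadraticExtension F E] in
/-- `y ↦ Φ(y, v)` as an `E`-LINEAR functional (print's "`E`-linear in the first variable").
[cite: GelbartRogawski1991, §3.1 p. 454 L37–38] -/
def leftFunctional (Φ : V →ₗ[F] V →ₗ[F] E) (hΦ₁ : ∀ (e : E) (x y : V), Φ (e • x) y = e * Φ x y) (v : V) :
    V →ₗ[E] E where
  toFun y := Φ y v
  map_add' y y' := by rw [map_add, LinearMap.add_apply]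
  map_smul' e y := by rw [hΦ₁, smul_eq_mul, RingHom.id_apply]

omit [NumberField F] [NumberField E] [Algebra.IsQuadraticExtension F E] [IsScalarTower F E V] in
/-- unfolding. [cite: GelbartRogawski1991, §3.1 p. 454 L37–38] -/
@[simp] theorem leftFunctional_apply (Φ : V →ₗ[F] V →ₗ[F] E) (hΦ₁ : ∀ (e : E) (x y : V), Φ (e • x) y = e * Φ x y)
    (v y : V) : leftFunctional F E Φ hΦ₁ v y = Φ y v := rfl

omit [NumberField F] [NumberField E] [Algebra.IsQuadraticExtension F E] in
/-- **the orthogonal complement `v^⊥ = {y | Φ(y, v) = 0}`** of a vector, an `E`-subspace.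
[cite: GelbartRogawski1991, §3.1 p. 454 L37–38] -/
def orthogonalComplement (Φ : V →ₗ[F] V →ₗ[F] E) (hΦ₁ : ∀ (e : E) (x y : V), Φ (e • x) y = e * Φ x y) (v : V) :
    Submodule E V :=
  LinearMap.ker (leftFunctional F E Φ hΦ₁ v)

omit [NumberField F] [NumberField E] [Algebra.IsQuadraticExtension F E] [IsScalarTower F E V] in
/-- membership in `v^⊥`. [cite: GelbartRogawski1991, §3.1 p. 454 L37–38] -/
theorem mem_orthogonalComplement (Φ : V →ₗ[F] V →ₗ[F] E) (hΦ₁ : ∀ (e : E) (x y : V), Φ (e • x) y = e * Φ x y)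
    (v y : V) : y ∈ orthogonalComplement F E Φ hΦ₁ v ↔ Φ y v = 0 :=
  LinearMap.mem_ker

omit [NumberField F] [NumberField E] [Algebra.IsQuadraticExtension F E] [IsScalarTower F E V] in
/-- **`dim v^⊥ = dim V - 1` for an anisotropic `v`** (rank–nullity: `y ↦ Φ(y, v)` is onto `E`).
[cite: GelbartRogawski1991, §3.1 p. 454 L37–38] -/
theorem finrank_orthogonalComplement_add_one [FiniteDimensional E V] (Φ : V →ₗ[F] V →ₗ[F] E)
    (hΦ₁ : ∀ (e : E) (x y : V), Φ (e • x) y = e * Φ x y) {v : V} (hv : Φ v v ≠ 0) :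
    finrank E (orthogonalComplement F E Φ hΦ₁ v) + 1 = finrank E V := by
  have hrange : LinearMap.range (leftFunctional F E Φ hΦ₁ v) = ⊤ := by
    rw [eq_top_iff]
    intro e _
    refine ⟨(e * (Φ v v)⁻¹) • v, ?_⟩
    rw [leftFunctional_apply, hΦ₁, inv_mul_cancel_right₀ hv]
  have h := LinearMap.finrank_range_add_finrank_ker (leftFunctional F E Φ hΦ₁ v)
  rw [hrange, finrank_top, Module.finrank_self] at h
  rw [orthogonalComplement, add_comm]
  exact h

omit [NumberField F] [NumberField E] [Algebra.IsQuadraticExtension F E] in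
/-- **the restriction of `Φ` to a subspace**, as an `F`-bilinear `E`-valued map (same printed axioms).
[cite: GelbartRogawski1991, §3.1 p. 454 L37–38] -/
def restrictForm (Φ : V →ₗ[F] V →ₗ[F] E) (W : Submodule E V) : W →ₗ[F] W →ₗ[F] E :=
  Φ.compl₁₂ (W.subtype.restrictScalars F) (W.subtype.restrictScalars F)

omit [NumberField F] [NumberField E] [Algebra.IsQuadraticExtension F E] in
/-- unfolding. [cite: GelbartRogawski1991, §3.1 p. 454 L37–38] -/
@[simp] theorem restrictForm_apply (Φ : V →ₗ[F] V →ₗ[F] E) (W : Submodule E V) (x y : W) :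
    restrictForm F E Φ W x y = Φ (x : V) (y : V) := rfl

omit [NumberField F] [Algebra.IsQuadraticExtension F E] in
include hσδ hδ in
/-- **the induction**: for every `n` and every `n`-dimensional skew-Hermitian space there is a `Φ`-orthogonal `E`-basis
indexed by `Fin n`. [cite: GelbartRogawski1991, §3.1 p. 454 L37–38] -/
theorem exists_orthogonal_basis_aux (n : ℕ) :
    ∀ (V : Type) [AddCommGroup V] [Module F V] [Module E V] [IsScalarTower F E V] [FiniteDimensional E V]
      (Φ : V →ₗ[F] V →ₗ[F] E), (∀ (e : E) (x y : V), Φ (e • x) y = e * Φ x y) →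
      (∀ x y : V, Φ y x = -σ (Φ x y)) → finrank E V = n →
      ∃ b : Basis (Fin n) E V, ∀ i j, i ≠ j → Φ (b i) (b j) = 0 := by
  induction n with
  | zero =>
    intro V _ _ _ _ _ Φ _ _ hn
    exact ⟨Module.finBasisOfFinrankEq E V hn, fun i => Fin.elim0 i⟩
  | succ n ih =>
    intro V _ _ _ _ _ Φ hΦ₁ hΦ₃ hn
    by_cases hΦ : Φ = 0
    · exact ⟨Module.finBasisOfFinrankEq E V hn, fun i j _ => by rw [hΦ, LinearMap.zero_apply, LinearMap.zero_apply]⟩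
    obtain ⟨v, hv⟩ := exists_apply_self_ne_zero F E σ hσδ hδ Φ hΦ₁ hΦ₃ hΦ
    -- split off `v`: `V = E v ⊕ v^⊥`
    set W := orthogonalComplement F E Φ hΦ₁ v with hW
    have hWn : finrank E W = n := by
      have h := finrank_orthogonalComplement_add_one F E Φ hΦ₁ hv
      rw [hn] at h
      exact Nat.succ_injective h
    obtain ⟨bW, hbW⟩ := ih W (restrictForm F E Φ W) (fun e x y => hΦ₁ e x y) (fun x y => hΦ₃ x y) hWn
    have hli : ∀ (c : E), ∀ x ∈ W, c • v + x = 0 → c = 0 := by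
      intro c x hx hcx
      have h := congrArg (fun z => Φ z v) hcx
      simp only [map_add, LinearMap.add_apply, map_zero, LinearMap.zero_apply, hΦ₁,
        (mem_orthogonalComplement F E Φ hΦ₁ v x).1 hx, add_zero, mul_eq_zero] at h
      exact h.resolve_right hv
    have hsp : ∀ z : V, ∃ c : E, z + c • v ∈ W := fun z =>
      ⟨-(Φ z v * (Φ v v)⁻¹), by
        rw [mem_orthogonalComplement, map_add, LinearMap.add_apply, hΦ₁, neg_mul, inv_mul_cancel_right₀ hv,
          add_neg_cancel]⟩
    refine ⟨Module.Basis.mkFinCons v bW hli hsp, ?_⟩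
    -- orthogonality, by cases on the two indices
    have hvW : ∀ x : W, Φ v x = 0 := fun x => by
      rw [hΦ₃, (mem_orthogonalComplement F E Φ hΦ₁ v x).1 x.2, map_zero, neg_zero]
    have hWv : ∀ x : W, Φ x v = 0 := fun x => (mem_orthogonalComplement F E Φ hΦ₁ v x).1 x.2
    intro i j hij
    rw [Module.Basis.coe_mkFinCons]
    cases i using Fin.cases with
    | zero =>
      cases j using Fin.cases with
      | zero => exact absurd rfl hij
      | succ j' =>
        rw [Fin.cons_zero, Fin.cons_succ, Function.comp_apply]
        exact hvW (bW j')
    | succ i' =>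
      cases j using Fin.cases with
      | zero =>
        rw [Fin.cons_succ, Fin.cons_zero, Function.comp_apply]
        exact hWv (bW i')
      | succ j' =>
        rw [Fin.cons_succ, Fin.cons_succ, Function.comp_apply, Function.comp_apply]
        exact hbW i' j' fun h => hij (congrArg Fin.succ h)

omit [NumberField F] [Algebra.IsQuadraticExtension F E] in
include hσδ hδ in
/-- **a skew-Hermitian space has a `Φ`-orthogonal `E`-basis** (any quadratic `E/F` with conjugation `σ ≠ 1`, any `Φ`,
degenerate or not). [cite: GelbartRogawski1991, §3.1 p. 454 L37–38] -/
theorem exists_orthogonal_basis [FiniteDimensional E V] (Φ : V →ₗ[F] V →ₗ[F] E)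
    (hΦ₁ : ∀ (e : E) (x y : V), Φ (e • x) y = e * Φ x y) (hΦ₃ : ∀ x y : V, Φ y x = -σ (Φ x y)) :
    ∃ b : Basis (Fin (finrank E V)) E V, ∀ i j, i ≠ j → Φ (b i) (b j) = 0 :=
  exists_orthogonal_basis_aux F E σ hσδ hδ (finrank E V) V Φ hΦ₁ hΦ₃ rfl

include hσδ hδ hd in
/-- **… with purely imaginary diagonal**: a `Φ`-orthogonal `E`-basis `b` and `f : Fin n → F` with `Φ(bᵢ, bᵢ) = fᵢ δ` — the
frame hypotheses `hb`, `hf` of `Prop311PrintedSymplecticFrame` / `…SymplecticRational`.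
[cite: GelbartRogawski1991, §3.1 p. 454 L37–42] -/
theorem exists_orthogonal_basis_imaginary [FiniteDimensional E V] (Φ : V →ₗ[F] V →ₗ[F] E)
    (hΦ₁ : ∀ (e : E) (x y : V), Φ (e • x) y = e * Φ x y) (hΦ₃ : ∀ x y : V, Φ y x = -σ (Φ x y)) :
    ∃ (b : Basis (Fin (finrank E V)) E V) (f : Fin (finrank E V) → F),
      (∀ i j, i ≠ j → Φ (b i) (b j) = 0) ∧ ∀ i, Φ (b i) (b i) = algebraMap F E (f i) * δ := by
  obtain ⟨b, hb⟩ := exists_orthogonal_basis F E σ hσδ hδ Φ hΦ₁ hΦ₃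
  exact ⟨b, fun i => im (quadraticRatCoords E (not_mem_range_algebraMap_of_apply_eq_neg E σ hσδ hδ)).toAddEquiv
    (Φ (b i) (b i)), hb, fun i => apply_self_eq_im_mul_delta F E σ hσδ hδ hd Φ hΦ₃ (b i)⟩

end Orthogonal

end Prop311

end Literature.NumberTheory.GelbartRogawski1991

end
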